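import Summits.CriticalPhenomena.SAWScalingLimit.Theorems.SAWDevelopingMapHexTransferPortDictionaryGadget
import Literature.Barriers.CriticalPhenomena.NienhuisWeightsExcludeVertexSAW
import Mathlib.Algebra.BigOperators.Ring.List
import HarnessLib

/-!
# Port dictionary, part 2: face-by-face route sums and the Glazman–Manolescu local weights

Support file for item stmt-CriticalPhenomena-6966 (`SAWCompassLattice.PortDictionary`), stub
`stub_portDictionary` of line `Sketch` of crux stmt-CriticalPhenomena-14221 (`HexTransfer`);
continues `…PortDictionaryGadget` (part 1).

* `W α β s z P U`: for a list `P` of ordered terminal pairs (the passages of a walk through ONE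
  face, in order) and a list `U` of already-used gadget vertices, the total weight
  `Σ ∏ᵢ z² · routeW rᵢ` over the families of pairwise vertex-disjoint routes `rᵢ : Pᵢ.1 → Pᵢ.2`
  avoiding `U` (defined recursively: choose the first route, then the others avoiding it).
* `W_eq_localWeight`: under the three compass equations `z²T_adj = u₁(π/2)`, `z²T_opp = v(π/2)`,
  `z⁴D = w₁(π/2)`, for every admissible passage list `P` (non-degenerate pairs, no pair repeated
  up to orientation) `W P [] = localWeight (π/2) (P.map kindOf)`, GM's local face weight of the
  corresponding arc kinds (`u₂ = u₁`, `w₂ = w₁` at `π/2` are the tree's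
  `weightU1_eq_weightU2_pi_div_two`, `weightW1_eq_weightW2_pi_div_two`); three or more passages,
  a shared terminal, or the crossing pairing give `0` on both sides.
-/

namespace Summit.CriticalPhenomena.SAWScalingLimit.Cruxes.HexTransfer.Sketch.PortDict

open Literature.Probability.RandomPlanarGeometry.SAW.YangBaxter

/-! ## The constrained route sums `W` -/

/-- **Face route sum.** `W α β s z P U = Σ ∏ᵢ (z² · routeW rᵢ)` over the families of pairwise
vertex-disjoint routes `rᵢ` from terminal `Pᵢ.1` to terminal `Pᵢ.2`, all avoiding `U`
(recursively: the first route, then the rest avoiding it as well). -/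
def W (α β s z : ℝ) : List (Fin 4 × Fin 4) → List Node → ℝ
  | [], _ => 1
  | p :: P, U => (((routes p.1 p.2).filter (avoidB U)).map
      fun r => z ^ 2 * routeW α β s r * W α β s z P (U ++ r)).sum

variable {α β s z : ℝ}

/-- `W` of no passage is `1`. -/
@[simp] theorem W_nil (U : List Node) : W α β s z [] U = 1 := rfl

/-- The defining recursion of `W`. -/
theorem W_cons (p : Fin 4 × Fin 4) (P : List (Fin 4 × Fin 4)) (U : List Node) :
    W α β s z (p :: P) U = (((routes p.1 p.2).filter (avoidB U)).map
      fun r => z ^ 2 * routeW α β s r * W α β s z P (U ++ r)).sum := rfl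

/-- A non-vanishing list sum has a non-vanishing term. -/
theorem exists_ne_zero_of_sum_map_ne_zero {ι : Type*} {l : List ι} {f : ι → ℝ}
    (h : (l.map f).sum ≠ 0) : ∃ a ∈ l, f a ≠ 0 := by
  by_contra hc
  push Not at hc
  exact h (List.sum_eq_zero (by simpa using hc))

/-- If `W P U ≠ 0`, every passage of `P` has a route avoiding `U`. -/
theorem exists_route_of_W_ne_zero {P : List (Fin 4 × Fin 4)} {U : List Node}
    (h : W α β s z P U ≠ 0) {q : Fin 4 × Fin 4} (hq : q ∈ P) :
    ∃ r ∈ routes q.1 q.2, ∀ x ∈ r, x ∉ U := by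
  induction P generalizing U with
  | nil => cases hq
  | cons p P ih =>
    rw [W_cons] at h
    obtain ⟨r, hr, hne⟩ := exists_ne_zero_of_sum_map_ne_zero h
    rw [List.mem_filter, avoidB_iff] at hr
    rcases List.mem_cons.1 hq with rfl | hq
    · exact ⟨r, hr.1, hr.2⟩
    · obtain ⟨r', hr', hav⟩ := ih (right_ne_zero_of_mul hne) hq
      exact ⟨r', hr', fun x hx hxU => hav x hx (List.mem_append_left _ hxU)⟩

/-- If `W P U ≠ 0`, any two passages of `P` (in order) have a pair of disjoint routes. -/
theorem exists_pair_of_W_ne_zero {P : List (Fin 4 × Fin 4)} {U : List Node}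
    (h : W α β s z P U ≠ 0) {p q : Fin 4 × Fin 4} (hpq : [p, q].Sublist P) :
    ∃ r₁ ∈ routes p.1 p.2, ∃ r₂ ∈ routes q.1 q.2, avoidB r₁ r₂ = true := by
  induction P generalizing U with
  | nil => simp at hpq
  | cons p' P ih =>
    rw [W_cons] at h
    obtain ⟨r, hr, hne⟩ := exists_ne_zero_of_sum_map_ne_zero h
    rw [List.mem_filter] at hr
    have h' : W α β s z P (U ++ r) ≠ 0 := right_ne_zero_of_mul hne
    rcases List.sublist_cons_iff.1 hpq with hsub | ⟨t, ht, hsub⟩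
    · exact ih h' hsub
    · obtain ⟨rfl, rfl⟩ : p' = p ∧ t = [q] := by
        simpa [List.cons_eq_cons] using ht.symm
      have hq : q ∈ P := List.singleton_sublist.1 hsub
      obtain ⟨r₂, hr₂, hav⟩ := exists_route_of_W_ne_zero h' hq
      exact ⟨r, hr.1, r₂, hr₂, avoidB_iff.2 fun x hx hxr => hav x hx (List.mem_append_right _ hxr)⟩

/-- Filtering by avoidance of nothing. -/
theorem filter_avoidB_nil (L : List (List Node)) : L.filter (avoidB []) = L :=
  List.filter_eq_self.2 fun r _ => by simp [avoidB]

/-- One passage, nothing to avoid: `W [p] [] = z² Σ_{routes} routeW`. -/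
theorem W_single (p : Fin 4 × Fin 4) :
    W α β s z [p] [] = z ^ 2 * ((routes p.1 p.2).map (routeW α β s)).sum := by
  rw [W_cons, filter_avoidB_nil, ← List.sum_map_mul_left]
  simp

/-- Two passages, nothing to avoid: `W [p, q] [] = z⁴ Σ_{r₁} routeW r₁ Σ_{r₂ avoiding r₁} routeW r₂`. -/
theorem W_pair (p q : Fin 4 × Fin 4) :
    W α β s z [p, q] [] = z ^ 4 * ((routes p.1 p.2).map fun r₁ => routeW α β s r₁ *
      (((routes q.1 q.2).filter (avoidB r₁)).map (routeW α β s)).sum).sum := by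
  rw [W_cons, filter_avoidB_nil, ← List.sum_map_mul_left]
  refine congrArg List.sum (List.map_congr_left fun r₁ _ => ?_)
  rw [W_cons, List.nil_append, ← List.sum_map_mul_left, ← List.sum_map_mul_left,
    ← List.sum_map_mul_left]
  refine congrArg List.sum (List.map_congr_left fun r₂ _ => ?_)
  simp only [W_nil]
  ring

/-- Edge fugacities are non-negative for non-negative `α, β, s`. -/
theorem edgeW_nonneg (hα : 0 ≤ α) (hβ : 0 ≤ β) (hs : 0 ≤ s) (q q' : Node) : 0 ≤ edgeW α β s q q' := by
  unfold edgeW; split_ifs <;> assumption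

/-- Route weights are non-negative for non-negative `α, β, s`. -/
theorem routeW_nonneg (hα : 0 ≤ α) (hβ : 0 ≤ β) (hs : 0 ≤ s) : ∀ r : List Node, 0 ≤ routeW α β s r
  | [] => by simp [routeW]
  | [_] => by simp [routeW]
  | q :: q' :: t => by
    rw [routeW]
    exact mul_nonneg (edgeW_nonneg hα hβ hs q q') (routeW_nonneg hα hβ hs (q' :: t))

/-- `W` is non-negative for non-negative `α, β, s`. -/
theorem W_nonneg (hα : 0 ≤ α) (hβ : 0 ≤ β) (hs : 0 ≤ s) :
    ∀ (P : List (Fin 4 × Fin 4)) (U : List Node), 0 ≤ W α β s z P U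
  | [], U => by simp
  | p :: P, U => by
    rw [W_cons]
    refine List.sum_nonneg fun x hx => ?_
    obtain ⟨r, -, rfl⟩ := List.mem_map.1 hx
    exact mul_nonneg (mul_nonneg (sq_nonneg z) (routeW_nonneg hα hβ hs r)) (W_nonneg hα hβ hs P _)

/-- The gadget has no loop. -/
theorem adjB_self (q : Node) : adjB q q = false := by
  revert q; decide

/-! ## Terminal pairs versus arc kinds -/

/-- The sides of a face in the cyclic order of the gadget's terminals (the item's `cyc`). -/
def cyc : Fin 4 → Side := ![Side.W, Side.N, Side.E, Side.S]

/-- The kind of the arc realised by a passage between two terminals. -/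
def kindOf (p : Fin 4 × Fin 4) : ArcKind := arcKind (cyc p.1) (cyc p.2)

/-- Two terminal pairs share a terminal. -/
def SharedB (p q : Fin 4 × Fin 4) : Bool := q.1 = p.1 ∨ q.1 = p.2 ∨ q.2 = p.1 ∨ q.2 = p.2

/-- Classification of one non-degenerate passage: adjacent terminals and a (co)corner arc, or
opposite terminals and a straight arc. -/
theorem single_cases : ∀ p : Fin 4 × Fin 4, p.1 ≠ p.2 →
    ((p.2 = p.1 + 1 ∨ p.1 = p.2 + 1) ∧ (kindOf p = .corner ∨ kindOf p = .coCorner)) ∨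
      (p.2 = p.1 + 2 ∧ kindOf p = .straight) := by
  decide

/-- Classification of two non-degenerate passages not repeating a pair: a shared terminal with
kinds other than two corners / two co-corners, or a non-crossing complementary pairing with two
corners or two co-corners, or the crossing pairing with two straight arcs. -/
theorem pair_cases : ∀ p q : Fin 4 × Fin 4, p.1 ≠ p.2 → q.1 ≠ q.2 → ¬(q = p ∨ q = (p.2, p.1)) →
    (SharedB p q = true ∧ ¬(kindOf p = .corner ∧ kindOf q = .corner) ∧
        ¬(kindOf p = .coCorner ∧ kindOf q = .coCorner)) ∨
    (((p.2 = p.1 + 1 ∧ (q.1 = p.1 + 2 ∧ q.2 = p.1 + 3 ∨ q.1 = p.1 + 3 ∧ q.2 = p.1 + 2)) ∨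
        (p.1 = p.2 + 1 ∧ (q.1 = p.2 + 2 ∧ q.2 = p.2 + 3 ∨ q.1 = p.2 + 3 ∧ q.2 = p.2 + 2))) ∧
      ((kindOf p = .corner ∧ kindOf q = .corner) ∨ (kindOf p = .coCorner ∧ kindOf q = .coCorner))) ∨
    ((p.2 = p.1 + 2 ∧ (q.1 = p.1 + 1 ∧ q.2 = p.1 + 3 ∨ q.1 = p.1 + 3 ∧ q.2 = p.1 + 1)) ∧
      kindOf p = .straight ∧ kindOf q = .straight) := by
  decide

/-- Pigeonhole: among three non-degenerate terminal pairs two share a terminal. -/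
theorem triple_shared : ∀ p q r : Fin 4 × Fin 4, p.1 ≠ p.2 → q.1 ≠ q.2 → r.1 ≠ r.2 →
    SharedB p q = true ∨ SharedB p r = true ∨ SharedB q r = true := by
  decide

/-- Passages sharing a terminal have no disjoint routes. -/
theorem not_avoid_of_shared {p q : Fin 4 × Fin 4} (h : SharedB p q = true) {r₁ r₂ : List Node}
    (hr₁ : r₁ ∈ routes p.1 p.2) (hr₂ : r₂ ∈ routes q.1 q.2) : avoidB r₁ r₂ = false := by
  have h' : q.1 = p.1 ∨ q.1 = p.2 ∨ q.2 = p.1 ∨ q.2 = p.2 := by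
    simpa [SharedB] using h
  have := filter_avoid_eq_nil_of_shared h' hr₁
  rw [List.filter_eq_nil_iff] at this
  simpa using this r₂ hr₂

/-- Two arcs of kinds other than two corners / two co-corners weigh `0`. -/
theorem localWeight_pair_eq_zero (θ : ℝ) {a b : ArcKind} (h1 : ¬(a = .corner ∧ b = .corner))
    (h2 : ¬(a = .coCorner ∧ b = .coCorner)) : localWeight θ [a, b] = 0 := by
  cases a <;> cases b <;> simp_all <;> rfl

/-- Three arcs or more weigh `0`. -/
theorem localWeight_three' (θ : ℝ) (a b c : ArcKind) (l : List ArcKind) :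
    localWeight θ (a :: b :: c :: l) = 0 := by
  cases a <;> cases b <;> rfl

/-- **Face weights.** Under the three compass equations, the constrained route sum of an
admissible passage list through one face is Glazman–Manolescu's local weight (at `θ = π/2`) of
the corresponding arc kinds: `z²T_adj = u₁ = u₂` (one (co)corner arc), `z²T_opp = v` (one straight
arc), `z⁴D = w₁ = w₂` (two (co)corner arcs), and `0` otherwise. -/
theorem W_eq_localWeight (hU : z ^ 2 * Tadj α β s = weightU1 (Real.pi / 2))
    (hV : z ^ 2 * Topp α β s = weightV (Real.pi / 2)) (hW : z ^ 4 * Dpair α β s = weightW1 (Real.pi / 2)) :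
    ∀ P : List (Fin 4 × Fin 4), (∀ p ∈ P, p.1 ≠ p.2) →
      P.Pairwise (fun p q => ¬(q = p ∨ q = (p.2, p.1))) →
      W α β s z P [] = localWeight (Real.pi / 2) (P.map kindOf)
  | [], _, _ => by simp [localWeight]
  | [p], hnd, _ => by
    rw [W_single]
    rcases single_cases p (hnd p (by simp)) with ⟨hadj, hk⟩ | ⟨hopp, hk⟩
    · rw [sum_routeW_adj α β s hadj, hU]
      rcases hk with hk | hk
      · simp [hk, localWeight]
      · simp [hk, localWeight, Literature.Barriers.CriticalPhenomena.weightU1_eq_weightU2_pi_div_two]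
    · rw [sum_routeW_opp α β s hopp, hV]
      simp [hk, localWeight]
  | [p, q], hnd, hpw => by
    rw [W_pair]
    have hp := hnd p (by simp)
    have hq := hnd q (by simp)
    have hpq : ¬(q = p ∨ q = (p.2, p.1)) := List.pairwise_pair.1 hpw
    rcases pair_cases p q hp hq hpq with ⟨hsh, h1, h2⟩ | ⟨hnc, hk⟩ | ⟨hcr, hk1, hk2⟩
    · rw [List.map_cons, List.map_cons, List.map_nil, localWeight_pair_eq_zero _ h1 h2]
      have : ∀ r₁ ∈ routes p.1 p.2, routeW α β s r₁ *
          (((routes q.1 q.2).filter (avoidB r₁)).map (routeW α β s)).sum = 0 := by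
        intro r₁ hr₁
        have hsh' : q.1 = p.1 ∨ q.1 = p.2 ∨ q.2 = p.1 ∨ q.2 = p.2 := by simpa [SharedB] using hsh
        rw [filter_avoid_eq_nil_of_shared hsh' hr₁]
        simp
      rw [List.sum_eq_zero (fun x hx => ?_), mul_zero]
      obtain ⟨r₁, hr₁, rfl⟩ := List.mem_map.1 hx
      exact this r₁ hr₁
    · rw [sum_pair_noncross α β s hnc, hW]
      rcases hk with ⟨hk1, hk2⟩ | ⟨hk1, hk2⟩
      · simp [hk1, hk2, localWeight]
      · simp [hk1, hk2, localWeight, Literature.Barriers.CriticalPhenomena.weightW1_eq_weightW2_pi_div_two]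
    · rw [List.map_cons, List.map_cons, List.map_nil, hk1, hk2]
      have : ∀ r₁ ∈ routes p.1 p.2, routeW α β s r₁ *
          (((routes q.1 q.2).filter (avoidB r₁)).map (routeW α β s)).sum = 0 := by
        intro r₁ hr₁
        rw [filter_avoid_eq_nil_of_cross hcr hr₁]
        simp
      rw [List.sum_eq_zero (fun x hx => ?_), mul_zero]
      · rfl
      obtain ⟨r₁, hr₁, rfl⟩ := List.mem_map.1 hx
      exact this r₁ hr₁
  | p :: q :: r :: rest, hnd, _ => by
    rw [List.map_cons, List.map_cons, List.map_cons, localWeight_three']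
    by_contra hne
    have hp := hnd p (by simp)
    have hq := hnd q (by simp)
    have hr := hnd r (by simp)
    have key : ∀ x y : Fin 4 × Fin 4, SharedB x y = true → [x, y].Sublist (p :: q :: r :: rest) → False := by
      intro x y hxy hsub
      obtain ⟨r₁, hr₁, r₂, hr₂, hav⟩ := exists_pair_of_W_ne_zero hne hsub
      rw [not_avoid_of_shared hxy hr₁ hr₂] at hav
      exact Bool.false_ne_true hav
    rcases triple_shared p q r hp hq hr with h | h | h
    · exact key p q h ((List.Sublist.refl [p, q]).trans (by simp))
    · refine key p r h ?_
      exact List.cons_sublist_cons.2 ((List.singleton_sublist.2 (by simp)))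
    · refine key q r h (List.Sublist.cons _ ?_)
      exact (List.Sublist.refl [q, r]).trans (by simp)

end Summit.CriticalPhenomena.SAWScalingLimit.Cruxes.HexTransfer.Sketch.PortDict
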